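import Summits.QuantumFields.BalabanUV.Beta.FP.TorusCompositeVertexJunctionSym

/-!
# `BalabanUV.Beta.FP.TorusCompositeRowsLatticeSym` — road «FP» for binder row D1, ROUTE T, (β1) «sym» column: **THE ENTRIES OF THE TOWER's SYM AVERAGING ROWS
# `compRowsSym` AS PERIOD SUMS OF an2's COMPOSITE LINEAR KERNEL OVER THE CENTRED SYM BRICKS, AND THE `perF` PACKAGING** — the `hQ`-type block identification
# `(perF T K).submatrix fμ (ff) = compRowsSym Lc M lev rs n` for ANY lattice kernel `K` whose multiplier–field block is the (scaled) kernel
# `u_n · compLinKer ℓˢ Lc n` read at the coarse points (the (β1) twin of `TorusCompositeRowsLattice` (p368487 ⧗); the chart-side half of the sym (C1)-0 junction)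

WHAT (every `d`, blocking `Lc ≠ 0` with `hc : ctrOff (d+1) Lc ∈ box (d+1) Lc`, box `M`, depth `n`, levels `lev`, ANY root list `rs` — the sym rows ignore it;
`T = towerTorus Lc M n`, `u_n = (∏_{i<n} stepScale d Lc (lev (i+1))) · #box^n`, `ℓˢ := fun _ => symLinKerAt (ctr (d+1) Lc) Lc`):
* §1 **`compRowsSym_apply_eq`** — the entries of the sym rows through ANY rows functional `𝓡` with the clauses `hR0 ∕ hRsucc` of `TorusCompositeRowsSymPeriodic` §3:
  `compRowsSym Lc M lev rs n (x,κ) (z,β) = 𝓡 lev n ((l, w) ↦ δ_{(β,z)} (l, wrap T w)) κ x` (§3 there at the periodic indicator of the torus bond; letter `hRper` from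
  `rows_periodic_of_clauses`).
* §2 **`compRowsSym_apply_eq_tsum`** — at F4-Sym's carrier (`symKernelFunctionals_spec`: `𝓡` = the kernel functional of `u_n · compLinKer ℓˢ Lc n`):
  `compRowsSym Lc M lev rs n (x,κ) (z,β) = u_n · Σ'_t compLinKer ℓˢ Lc n (β, z + T∘t) (κ, x)` — the period sum of the kernel (`tsum_mul_indicator_wrap` on an2's window
  `compLinKer_eq_zero`).
* §3 **`smul_perF_submatrix_eq_smul_compRowsSym`** ∕ **`perF_submatrix_eq_compRowsSym`** — for ANY `K : MKer (d+1) (Fib d)` with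
  `K X w (inr κ) (inl β) = [proj (Lc^n) X = 0] · s · compLinKer ℓˢ Lc n (β, w) (κ, quo (Lc^n) X)` and ANY coarse presentation `fμ` of the `M`-slots in `T` reading
  `a ↦ (Lc^n • a.1, inr a.2)`: `u_n • (perF T K).submatrix fμ (b ↦ (b.1, inl b.2)) = s • compRowsSym Lc M lev rs n`, and ON THE NOSE when `s = u_n`.
[folklore] BY NAME (`TorusCompositeRowsSymPeriodic` §3, `TorusCompositeInsertionPeriodicSym.rows_periodic_of_clauses`, F4-Sym's `symKernelFunctionals_spec`,
`TorusCompositeInsertionKernel.tsum_mul_indicator_wrap`, `perF_apply ∕ perZ_apply ∕ proj_zsmul ∕ quo_zsmul`); no `def`, no `def … : Prop`, nothing cited, 0 sorry;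
NO chart; nothing of Bałaban's asserted — that a chart's border IS this kernel is an2's (C1) TABLE word at order 0.

HONEST DEPENDENCY (page 1, mandatory): continuum YM on T⁴ ⇐ BetaPertH ∧ nine spine estimates (0/9 proved); BetaPertH ⇐ (D1) ∧ (D4) ∧ CAP+tail;
G-an2-4 gates asym, D1 and NE2/3/4.  HONEST FRAMING (cell contract, verbatim): «discharging `BetaPertH` makes Bałaban's UV stability UNCONDITIONAL —
a real constructive-QFT result; it is NOT the continuum limit and NOT the Clay problem.»  ABSOLUTE RULE (cell charter, verbatim): «No internally-minted
statement may enter as a cited fact. Every hypothesis is either kernel-proved in this package or a verbatim quotation of a PUBLISHED theorem with page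
reference. The manuscript(s) under audit are NOT citable for their own disputed steps — they are the thing under adjudication; programme-internal
(2001/route/tribunal) claims are never citable.»  0 estimates; 0∕4 row-D1 binders (hW, hR, D1Tel, D1Rep); NOT (T-ID), NOT (C1), NOT SDF, NOT D1,
NOT BetaPertH, NOT continuum, NOT Clay.  D1 formalisation swarm LEAF PROVER 02 (b2b-balaban-beta-d1-formalise-leaf-02 gen 32), 2026-08-24.  No existing file touched.
v1.1 (leaf-02 g33, 2026-08-25): `tsum_mul_indicator_wrap` opened from the rooted R-9 `TorusCompositeInsertionKernel` (R-29 v1.1 no longer re-types it); every declaration byte-identical to v1 fba55eadb44200a9.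
-/

noncomputable section

open scoped BigOperators

namespace Summit.QuantumFields.BalabanUV.Beta.FP.TorusCompositeRowsLatticeSym

open Finset
open Literature.MathematicalPhysics.QuantumFieldTheory
open Literature.MathematicalPhysics.QuantumFieldTheory.Balaban1983to89
open Literature.MathematicalPhysics.QuantumFieldTheory.Balaban1983to89.Beta
open B6Lemma24Torus (pbox wrap wrap_congr)
open B4TorusKernel.MultiPeriod (translate translate_apply)
open Literature.Probability.LatticeModels (Torus.proj)
open ExpKernelCalculus (MKer)
open AffineAveraging (Site Form1 box toSite)
open AveragingContoursRooted (ctr ctrOff)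
open AveragingHessianKernels (Bond)
open OneStepResolventKernel (Fib proj_zsmul quo_zsmul)
open LatticeForm (quo)
open KKTFluctuationKernel (delta1 delta1_apply)
open Summit.QuantumFields.BalabanUV.Beta.BorderedHessian (stepScale stepScale_ne_zero)
open Summit.QuantumFields.BalabanUV.Beta.SymAveragingHessianCounts (symLinKerAt)
open Summit.QuantumFields.BalabanUV.Beta.FP.KernelPeriodisationFib (Idx perF perF_apply perZ perZ_apply)
open Summit.QuantumFields.BalabanUV.Beta.FP.TorusCompositeObjects (towerTorus)
open Summit.QuantumFields.BalabanUV.Beta.FP.TorusCompositeObjectsG (compRowsSym)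
open Summit.QuantumFields.BalabanUV.Beta.CompositeVertexKernelRec (winF wid compLinKer compLinKer_eq_zero)
open Summit.QuantumFields.BalabanUV.Beta.FP.TorusCompositeRowsSymPeriodic (sum_compRowsSym_mul_periodic_of_clauses)
open Summit.QuantumFields.BalabanUV.Beta.FP.TorusCompositeInsertionPeriodicSym (rows_periodic_of_clauses)
open Summit.QuantumFields.BalabanUV.Beta.FP.TorusCompositeInsertionKernel (tsum_mul_indicator_wrap)
open Summit.QuantumFields.BalabanUV.Beta.FP.TorusCompositeVertexJunctionSym (symKernelFunctionals_spec)

variable {d : ℕ} (Lc : ℕ) [NeZero Lc]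

/-! ## §1 The entries of the sym rows through any rows functional obeying the sym one-step law -/

/-- [folklore] **THE ENTRIES OF THE SYM AVERAGING ROWS**: for any `𝓡` with `TorusCompositeRowsSymPeriodic` §3's clauses `hR0 ∕ hRsucc` (letter `hRper` from
`rows_periodic_of_clauses`), `compRowsSym Lc M lev rs n (x, κ) (z, β) = 𝓡 lev n ((l, w) ↦ δ_{(β,z)} (l, wrap T w)) κ x`, `T = towerTorus Lc M n`. -/
theorem compRowsSym_apply_eq (𝓡 : (ℕ → ℕ) → ℕ → Form1 (d + 1) ℝ → Form1 (d + 1) ℝ)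
    (hR0 : ∀ (lev : ℕ → ℕ) (B : Form1 (d + 1) ℝ), 𝓡 lev 0 B = B)
    (hRsucc : ∀ (lev : ℕ → ℕ) (n : ℕ) (B : Form1 (d + 1) ℝ) (κ : Fin (d + 1)) (x : Site (d + 1)),
      𝓡 lev (n + 1) B κ x = stepScale d Lc (lev 1) * ((Lc : ℝ) ^ (d + 1)
        * ∑' z : Site (d + 1), ∑ l : Fin (d + 1), symLinKerAt (ctr (d + 1) Lc) Lc κ x (l, z) * 𝓡 (fun k => lev (k + 1)) n B l z))
    (n : ℕ) (M : Fin (d + 1) → ℕ) [∀ μ, NeZero (M μ)] (lev : ℕ → ℕ) (rs : ℕ → (Fin (d + 1) → ℕ))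
    (x : ↥(pbox M)) (κ : Fin (d + 1)) (z : ↥(pbox (towerTorus Lc M n))) (β : Fin (d + 1)) :
    compRowsSym Lc M lev rs n (x, κ) (z, β)
      = 𝓡 lev n (fun l w => delta1 β (z : Site (d + 1)) l (wrap (towerTorus Lc M n) w)) κ (x : Site (d + 1)) := by
  classical
  have hA : ∀ (l : Fin (d + 1)) (w t : Site (d + 1)),
      (fun l w => delta1 β (z : Site (d + 1)) l (wrap (towerTorus Lc M n) w)) l (translate (towerTorus Lc M n) w t)
        = (fun l w => delta1 β (z : Site (d + 1)) l (wrap (towerTorus Lc M n) w)) l w := fun l w t => by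
    show delta1 β _ l (wrap _ (translate _ w t)) = delta1 β _ l (wrap _ w)
    rw [wrap_congr (x' := w)]
    intro i
    rw [translate_apply]
    exact ⟨t i, by ring⟩
  rw [← sum_compRowsSym_mul_periodic_of_clauses Lc 𝓡 hR0 hRsucc (fun lev n T B => rows_periodic_of_clauses Lc 𝓡 hR0 hRsucc n lev T B)
    n M lev rs _ hA x κ]
  have hval : ∀ q : ↥(pbox (towerTorus Lc M n)) × Fin (d + 1),
      (fun l w => delta1 β (z : Site (d + 1)) l (wrap (towerTorus Lc M n) w)) q.2 (q.1 : Site (d + 1)) = if q = (z, β) then 1 else 0 := fun q => by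
    show delta1 β _ q.2 (wrap _ _) = _
    rw [B6Lemma24Torus.wrap_eq_self q.1.2, delta1_apply]
    obtain ⟨w, l⟩ := q
    by_cases hq : (w, l) = (z, β)
    · rw [if_pos hq, if_pos]
      obtain ⟨h1, h2⟩ := Prod.mk.inj hq
      exact ⟨h2, by rw [h1]⟩
    · rw [if_neg hq, if_neg]
      rintro ⟨h2, h1⟩
      exact hq (Prod.ext (Subtype.ext h1) h2)
  simp only [hval, mul_ite, mul_one, mul_zero, Finset.sum_ite_eq', Finset.mem_univ, if_true]

/-! ## §2 The entries at F4-Sym's carrier: period sums of an2's composite linear kernel over the sym bricks -/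

/-- [folklore] **`compRowsSym_apply_eq_tsum` — THE SYM ROWS' ENTRIES ARE PERIOD SUMS OF THE COMPOSITE LINEAR KERNEL**:
`compRowsSym Lc M lev rs n (x, κ) (z, β) = u_n · Σ'_t compLinKer ℓˢ Lc n (β, z + T∘t) (κ, x)`, `u_n = (∏_{i<n} stepScale d Lc (lev (i+1))) · #box^n` (§1 at
`symKernelFunctionals_spec`'s `𝓡`, then `tsum_mul_indicator_wrap` on an2's window `compLinKer_eq_zero`). -/
theorem compRowsSym_apply_eq_tsum (hc : ctrOff (d + 1) Lc ∈ box (d + 1) Lc) (n : ℕ) (M : Fin (d + 1) → ℕ) [∀ μ, NeZero (M μ)] (lev : ℕ → ℕ)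
    (rs : ℕ → (Fin (d + 1) → ℕ)) (x : ↥(pbox M)) (κ : Fin (d + 1)) (z : ↥(pbox (towerTorus Lc M n))) (β : Fin (d + 1)) :
    compRowsSym Lc M lev rs n (x, κ) (z, β)
      = ((∏ i ∈ range n, stepScale d Lc (lev (i + 1))) * ((box (d + 1) Lc).card : ℝ) ^ n) *
          ∑' t : Site (d + 1), compLinKer (fun _ : ℕ => symLinKerAt (ctr (d + 1) Lc) Lc) Lc n (β, translate (towerTorus Lc M n) (z : Site (d + 1)) t)
            (κ, (x : Site (d + 1))) := by
  classical
  obtain ⟨𝓡, 𝓘, hR0, hRsucc, h0, hsucc, hR, hI⟩ := symKernelFunctionals_spec (d := d) Lc hc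
  rw [compRowsSym_apply_eq Lc 𝓡 hR0 hRsucc n M lev rs x κ z β, hR]
  refine congrArg (fun t : ℝ => ((∏ i ∈ range n, stepScale d Lc (lev (i + 1))) * ((box (d + 1) Lc).card : ℝ) ^ n) * t) ?_
  -- the bond sum against the periodic indicator keeps the direction `β` only
  have hsingle : ∀ w : Site (d + 1), (∑ m : Fin (d + 1), compLinKer (fun _ : ℕ => symLinKerAt (ctr (d + 1) Lc) Lc) Lc n (m, w) (κ, (x : Site (d + 1))) *
      (fun l w => delta1 β (z : Site (d + 1)) l (wrap (towerTorus Lc M n) w)) m w)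
        = compLinKer (fun _ : ℕ => symLinKerAt (ctr (d + 1) Lc) Lc) Lc n (β, w) (κ, (x : Site (d + 1))) *
            (if wrap (towerTorus Lc M n) w = (z : Site (d + 1)) then (1 : ℝ) else 0) := fun w => by
    rw [Finset.sum_eq_single β (fun m _ hm => ?_) (fun h => (h (Finset.mem_univ β)).elim)]
    · show _ * delta1 β _ β (wrap _ w) = _
      rw [delta1_apply]
      by_cases hw : wrap (towerTorus Lc M n) w = (z : Site (d + 1))
      · rw [if_pos ⟨rfl, hw⟩, if_pos hw]
      · rw [if_neg (fun h => hw h.2), if_neg hw]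
    · show _ * delta1 β _ m (wrap _ w) = 0
      rw [delta1_apply, if_neg (fun h => hm h.1), mul_zero]
  rw [tsum_congr hsingle]
  exact tsum_mul_indicator_wrap (towerTorus Lc M n)
    (fun w => compLinKer (fun _ : ℕ => symLinKerAt (ctr (d + 1) Lc) Lc) Lc n (β, w) (κ, (x : Site (d + 1))))
    (winF (Lc ^ n) (wid Lc n) (x : Site (d + 1))) (fun w hw => compLinKer_eq_zero n (f := (β, w)) hw) z

/-! ## §3 The `perF` packaging: the `hQ`-type block identification against the sym rows -/

/-- [folklore] **THE `perF` PACKAGING — THE BLOCK IDENTIFICATION `Q♯ = compRowsSym`**: for ANY lattice kernel `K` whose multiplier–field block is `s ·` an2's composite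
linear kernel over the sym bricks read at the coarse points of scale `Lc^n` (`K X w (inr κ) (inl β) = [proj (Lc^n) X = 0] · s · compLinKer ℓˢ Lc n (β, w) (κ, X ∕ Lc^n)`)
and ANY coarse presentation `fμ` of the `M`-slots in `T = towerTorus Lc M n` reading `a ↦ (Lc^n • a.1, inr a.2)`:
`u_n • (perF T K).submatrix fμ (b ↦ (b.1, inl b.2)) = s • compRowsSym Lc M lev rs n`. -/
theorem smul_perF_submatrix_eq_smul_compRowsSym (hc : ctrOff (d + 1) Lc ∈ box (d + 1) Lc) (n : ℕ) (M : Fin (d + 1) → ℕ) [∀ μ, NeZero (M μ)]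
    (lev : ℕ → ℕ) (rs : ℕ → (Fin (d + 1) → ℕ)) (s : ℝ) {K : MKer (d + 1) (Fib d)}
    (hK : ∀ (X w : Site (d + 1)) (κ β : Fin (d + 1)), K X w (Sum.inr κ) (Sum.inl β)
      = if Torus.proj (Lc ^ n) X = 0 then s * compLinKer (fun _ : ℕ => symLinKerAt (ctr (d + 1) Lc) Lc) Lc n (β, w) (κ, quo (Lc ^ n) X) else 0)
    (fμ : ↥(pbox M) × Fin (d + 1) → Idx (towerTorus Lc M n) (Fib d))
    (hfμ₁ : ∀ a, ((fμ a).1 : Site (d + 1)) = ((Lc ^ n : ℕ) : ℤ) • (a.1 : Site (d + 1))) (hfμ₂ : ∀ a, (fμ a).2 = Sum.inr a.2) :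
    ((∏ i ∈ range n, stepScale d Lc (lev (i + 1))) * ((box (d + 1) Lc).card : ℝ) ^ n) •
        (perF (towerTorus Lc M n) K).submatrix fμ
          (fun b : ↥(pbox (towerTorus Lc M n)) × Fin (d + 1) => ((b.1, Sum.inl b.2) : Idx (towerTorus Lc M n) (Fib d)))
      = s • compRowsSym Lc M lev rs n := by
  haveI : NeZero (Lc ^ n) := ⟨pow_ne_zero _ (NeZero.ne Lc)⟩
  ext ⟨x, κ⟩ ⟨z, β⟩
  rw [Matrix.smul_apply, Matrix.smul_apply, Matrix.submatrix_apply, perF_apply, hfμ₁, hfμ₂, perZ_apply,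
    compRowsSym_apply_eq_tsum Lc hc n M lev rs x κ z β, smul_eq_mul, smul_eq_mul]
  have hp : Torus.proj (Lc ^ n) (((Lc ^ n : ℕ) : ℤ) • (x : Site (d + 1))) = 0 := proj_zsmul (N := Lc ^ n) _
  have hq : quo (Lc ^ n) (((Lc ^ n : ℕ) : ℤ) • (x : Site (d + 1))) = (x : Site (d + 1)) := quo_zsmul (N := Lc ^ n) _
  simp only [hK, if_pos hp, hq]
  rw [tsum_mul_left]
  ring

/-- [folklore] the same ON THE NOSE when the kernel's border carries exactly the tower's unit `u_n`:
`(perF T K).submatrix fμ (b ↦ (b.1, inl b.2)) = compRowsSym Lc M lev rs n` — the `hQ`-type block identification of a lattice chart against the tower's sym averaging rows. -/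
theorem perF_submatrix_eq_compRowsSym (hc : ctrOff (d + 1) Lc ∈ box (d + 1) Lc) (n : ℕ) (M : Fin (d + 1) → ℕ) [∀ μ, NeZero (M μ)]
    (lev : ℕ → ℕ) (rs : ℕ → (Fin (d + 1) → ℕ)) {K : MKer (d + 1) (Fib d)}
    (hK : ∀ (X w : Site (d + 1)) (κ β : Fin (d + 1)), K X w (Sum.inr κ) (Sum.inl β)
      = if Torus.proj (Lc ^ n) X = 0 then
          ((∏ i ∈ range n, stepScale d Lc (lev (i + 1))) * ((box (d + 1) Lc).card : ℝ) ^ n) *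
            compLinKer (fun _ : ℕ => symLinKerAt (ctr (d + 1) Lc) Lc) Lc n (β, w) (κ, quo (Lc ^ n) X)
        else 0)
    (fμ : ↥(pbox M) × Fin (d + 1) → Idx (towerTorus Lc M n) (Fib d))
    (hfμ₁ : ∀ a, ((fμ a).1 : Site (d + 1)) = ((Lc ^ n : ℕ) : ℤ) • (a.1 : Site (d + 1))) (hfμ₂ : ∀ a, (fμ a).2 = Sum.inr a.2) :
    (perF (towerTorus Lc M n) K).submatrix fμ
        (fun b : ↥(pbox (towerTorus Lc M n)) × Fin (d + 1) => ((b.1, Sum.inl b.2) : Idx (towerTorus Lc M n) (Fib d)))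
      = compRowsSym Lc M lev rs n := by
  have hS : ((∏ i ∈ range n, stepScale d Lc (lev (i + 1))) * ((box (d + 1) Lc).card : ℝ) ^ n) ≠ 0 :=
    mul_ne_zero (Finset.prod_ne_zero_iff.2 fun i _ => stepScale_ne_zero _)
      (pow_ne_zero _ (by exact_mod_cast (Finset.card_pos.mpr ⟨ctrOff (d + 1) Lc, hc⟩).ne'))
  have h := smul_perF_submatrix_eq_smul_compRowsSym Lc hc n M lev rs _ hK fμ hfμ₁ hfμ₂
  exact smul_right_injective _ hS h

end Summit.QuantumFields.BalabanUV.Beta.FP.TorusCompositeRowsLatticeSym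

end
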